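import Summits.ResolutionOfSingularities.ResolutionOfSingularities.Theorems.PurelyInseparableDim4ChartAtlasSNCFarRepairReadingHeights
import Summits.ResolutionOfSingularities.ResolutionOfSingularities.Theorems.PurelyInseparableDim4ChartAtlasSNCFarRepairCentrePairs
import HarnessLib

/-!
# Purely inseparable four-folds `z^p + F(x₁, …, x₄)`: THE READING OF THE ESCAPING CENTRE AFTER THE FAR-RESONANCE REPAIR, ON THE STAGE `W`
# (pair-list boundary; cell `res-dim4-pi`, typ-2 g8; HANDOFF g7 OPEN 4 «post-repair readings on W», the data a walk needs to CONTINUE after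
# `farSide_globalCentre_pairs_every` p721332 / `admissible_strictTransform_after_farRepairW_pairs` p720641)

[OURS · counted 0] (D-0157 DOOR 2; DR-157-C.) Setting of p720422 / p720641 (`π : W → 𝔸⁵` ANY blowing up along `V(z, x_S)`, chart `j ∈ S`, `b_j = 0`,
re-centring `Θⱼ` of record with `z^p + F ↦ x_j^p (z^p + F₁)`, `F₁` `S'`-permissible, escaping case `j ∉ S'`, pair-list boundary `L`,
`M′ = ((z^p + F)·𝒪, E_L, p).transform π 𝓘Λ_S`, global centre `Zc = 𝓘(closure φⱼ V(z, x_{S'}))`, heights `hs ≠ []` nodup non-zero, repair centre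
`C_W = 𝓘(closure φⱼ V(C(hs)))`), and ANY blowing up `τ : W″ → W` along `C_W` (p720641: `St_τ(Zc)` is then admissible). PROVED here (no `sorry`, no
new axiom) — the chart-model reading `farRepair_chart_reading_heights` transported along p718958's restriction of `τ` over `φⱼ(𝔸⁵)`:

* **`farRepair_reading_W_pairs`** — there is an OPEN IMMERSION `φ : 𝔸⁵ → W″`, lying over the `x_j`-chart (`φ ≫ τ` factors through `φⱼ(𝔸⁵)`), with:
  (1) `St_τ(Zc)` reads `𝓘Λ_{S'} = V(y_0, y_{S'})`; (2) every point of `V(St_τ(Zc))` over `φⱼ(𝔸⁵)` lies in `φ(𝔸⁵)` (over the `x_j`-chart the new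
  member is covered by this ONE chart; off `V(C_W)` — in particular outside `φⱼ(𝔸⁵)` — `τ` is an isomorphism and the old shear charts of
  p714892's atlas apply unchanged); (3) `(M′.transform τ C_W).ideal` reads `(z^p + F₁⁽ʰˢ⁾)·𝒪` with `(h_last, F₁⁽ʰˢ⁾)` the fold of
  `(h_prev, G) ↦ (h, (CentreBlowup.step p (insert j S') j 0 ⟨G(y_j + (h − h_prev)), 0, ∅⟩).F)` over `hs` from `(0, F₁)` — the new main READING's
  state; (4) `S'` permissible for it; (5) the new exceptional member `τ^*C_W` reads `Π_{h ∈ hs} (y_j + (h_last − h))·𝒪`;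
  (6)–(8) an old member `D` of `M′.boundary` whose `φⱼ`-reading (p720422 `forall_mem_transform_boundary_comap_chart_pairs`) is an index-`j`
  hyperplane `(y_j + a)` / a near member `y_t` (`t ∈ S'`) / a transversal member `(yᵢ + a)` (`i ∉ S' ∪ {j}`) has `St_τ(D)` reading
  `⊤` or `(y_j + (a + h_last))` (as `−a ∈ hs` or not) / `y_t` / `(yᵢ + a)`;
* `disjoint_support_strictTransform_of_disjoint` — a member missing `V(Zc)` has strict transform missing `V(St_τ Zc)` (generic).

So, in typ-3's v4 currency (memo S3c-V4 §13 (c)): after the SUB-CENTRE STEP along `C_W` the new node `St(Zc)` has the main reading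
`(F₁⁽ʰˢ⁾, S', …)` on the chart `φ` over `x_j`, and its other readings are the old extra readings off `V(C_W)`. Far quadrics meeting `St(Zc)` (active,
non-resonant) are read by p723327 for one height. Nothing here is a statement about resolution of singularities in dimension ≥ 4 / characteristic `p`
(NOT proved anywhere in this programme). bears_on: LADDER-RESOLUTION:D157-DOOR2 (res-dim4-pi). Supports stmt-ResolutionOfSingularities-16155 (helper).
-/

-- every declaration of this summit lives under `Summit.ResolutionOfSingularities.ResolutionOfSingularities`
-- (summit = problem), which the duplicate-namespace linter flags; house convention (cf. the Target file).
set_option linter.dupNamespace false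

noncomputable section

open MvPolynomial CategoryTheory AlgebraicGeometry Opposite TopologicalSpace
open AlgebraicGeometry.Scheme.IdealSheafData (ofIdealTop vanishingIdeal)

namespace Summit.ResolutionOfSingularities.ResolutionOfSingularities.Theorems.PIDim4

open Literature.AlgebraicGeometry.Resolution
open Literature.AlgebraicGeometry.Resolution.Hauser2010
open Literature.AlgebraicGeometry.Resolution.AffinePointBlowup (P A γ coord Wtop ξ)
open Literature.Barriers.ResolutionOfSingularities

namespace ChartDictionary

/-! ## §1 A member missing the centre keeps missing its strict transform -/

section Generic

universe u

variable {X X' : Scheme.{u}} {τ : X' ⟶ X} {C D Z : X.IdealSheafData}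

/-- **A member missing `V(Z)` has strict transform missing `V(St_τ Z)`** (both lie over their originals). -/
theorem disjoint_support_strictTransform_of_disjoint [IsLocallyNoetherian X] [IsLocallyNoetherian X']
    (hDZ : Disjoint (D.support : Set X) (Z.support : Set X)) :
    Disjoint ((strictTransformIdeal τ C D).support : Set X') ((strictTransformIdeal τ C Z).support : Set X') :=
  Set.disjoint_left.mpr fun _ hxD hxZ =>
    hDZ.le_bot ⟨mem_support_of_mem_support_strictTransformIdeal hxD, mem_support_of_mem_support_strictTransformIdeal hxZ⟩

end Generic

/-! ## §2 The post-repair reading on the stage -/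

section Stage

variable {K : Type} [Field K] {p : ℕ} [hp : Fact p.Prime] [CharP K p]
  {S S' : Finset (Fin 4)} {j : Fin 4} {b : Fin 4 → K} {Θⱼ : A 4 K ≃ₐ[K] A 4 K} {h : MvPolynomial (Fin 4) K}
  {F F₁ : MvPolynomial (Fin 4) K} {W : Scheme.{0}} {π : W ⟶ P 4 K}

/-- **THE POST-REPAIR READING ON `W` (pair-list boundary, any finite number of heights).** See the module docstring for the clauses. -/
theorem farRepair_reading_W_pairs [IsAlgClosed K] [DecidableEq K] (hj : j ∈ S) (hjS' : j ∉ S') (hbj : b j = 0)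
    (h0j : Θⱼ (X 0) = X 0 + rename Fin.succ h) (hsj : ∀ i : Fin 4, Θⱼ (X i.succ) = X i.succ + C (b i))
    (hπ : IsBlowup π (AffineCoordBlowup.𝓘Λ 4 K (insert 0 (Fin.succ '' (S : Set (Fin 4))))))
    (hperm : (p : ℕ∞) ≤ CentreBlowup.ordAlong S F)
    (hread : Θⱼ (coordBlowupSubst K (insert 0 (Fin.succ '' (S : Set (Fin 4)))) j.succ (hyp p F)) = X j.succ ^ p * hyp p F₁)
    (hperm' : (p : ℕ∞) ≤ CentreBlowup.ordAlong S' F₁) (L : List (Fin 4 × K))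
    (hs : List K) (hne : hs ≠ []) (hnd : hs.Nodup) (h0 : ∀ h' ∈ hs, h' ≠ 0) :
    haveI : IsIso (CommRingCat.ofHom (Θⱼ : A 4 K →+* A 4 K)) := (inferInstance : IsIso Θⱼ.toRingEquiv.toCommRingCatIso.hom)
    let φⱼ := Spec.map (CommRingCat.ofHom (Θⱼ : A 4 K →+* A 4 K)) ≫ AffineCoordBlowup.chartImm hπ (succ_mem_centreVars hj)
    let Zc := vanishingIdeal (closureImage φⱼ ((AffineCoordBlowup.𝓘Λ 4 K (insert 0 (Fin.succ '' (S' : Set (Fin 4))))).support : Set (P 4 K)))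
    let M' := ((⟨hypSheaf p F, L.map fun ic => ofIdealTop (Ideal.span {(γ 4 K).symm (X ic.1.succ + C ic.2)}), p⟩ :
        MarkedIdeal (P 4 K)).transform π (AffineCoordBlowup.𝓘Λ 4 K (insert 0 (Fin.succ '' (S : Set (Fin 4))))))
    let Cmod := (hs.map fun h' => (AffineCoordBlowup.𝓘Λ 4 K (insert 0 (Fin.succ '' ((insert j S' : Finset (Fin 4)) : Set (Fin 4))))).comap
      (Spec.map (CommRingCat.ofHom ((AffinePointBlowup.translateEquiv (n := 4) (Pi.single j.succ (-h')) : A 4 K ≃ₐ[K] A 4 K) :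
        A 4 K →+* A 4 K)))).prod
    let CW := vanishingIdeal (closureImage φⱼ (Cmod.support : Set (P 4 K)))
    let out := hs.foldl (fun (acc : K × MvPolynomial (Fin 4) K) (h' : K) =>
      (h', (CentreBlowup.step p (insert j S') j 0 ⟨PointBlowup.translate (Pi.single j (h' - acc.1)) acc.2, 0, ∅⟩).F)) (0, F₁)
    ∀ ⦃W'' : Scheme.{0}⦄ ⦃τ : W'' ⟶ W⦄, IsBlowup τ CW →
      ∃ (φ : P 4 K ⟶ W'') (_ : IsOpenImmersion φ),
        Set.range (φ ≫ τ) ⊆ Set.range φⱼ ∧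
        (strictTransformIdeal τ CW Zc).comap φ = AffineCoordBlowup.𝓘Λ 4 K (insert 0 (Fin.succ '' (S' : Set (Fin 4)))) ∧
        (∀ x : W'', x ∈ ((strictTransformIdeal τ CW Zc).support : Set W'') → τ x ∈ Set.range φⱼ → x ∈ Set.range φ) ∧
        (M'.transform τ CW).ideal.comap φ = hypSheaf p out.2 ∧
        (p : ℕ∞) ≤ CentreBlowup.ordAlong S' out.2 ∧
        (CW.comap τ).comap φ = (hs.map fun h' => ofIdealTop (Ideal.span {(γ 4 K).symm (X j.succ + C (out.1 - h'))})).prod ∧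
        (∀ (D : Scheme.IdealSheafData W) (a : K), D.comap φⱼ = ofIdealTop (Ideal.span {(γ 4 K).symm (X j.succ + C a)}) →
          (strictTransformIdeal τ CW D).comap φ =
            if -a ∈ hs then ⊤ else ofIdealTop (Ideal.span {(γ 4 K).symm (X j.succ + C (a + out.1))})) ∧
        (∀ (D : Scheme.IdealSheafData W), ∀ t ∈ S', D.comap φⱼ = ofIdealTop (Ideal.span {(γ 4 K).symm (X t.succ + C 0)}) →
          (strictTransformIdeal τ CW D).comap φ = ofIdealTop (Ideal.span {(γ 4 K).symm (X t.succ + C 0)})) ∧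
        (∀ (D : Scheme.IdealSheafData W), ∀ i ∉ S', i ≠ j → ∀ a : K, D.comap φⱼ = ofIdealTop (Ideal.span {(γ 4 K).symm (X i.succ + C a)}) →
          (strictTransformIdeal τ CW D).comap φ = ofIdealTop (Ideal.span {(γ 4 K).symm (X i.succ + C a)})) := by
  intro φⱼ Zc M' Cmod CW out W'' τ hτ
  classical
  haveI hisoj : IsIso (CommRingCat.ofHom (Θⱼ : A 4 K →+* A 4 K)) := (inferInstance : IsIso Θⱼ.toRingEquiv.toCommRingCatIso.hom)
  haveI : PerfectRing K p := PerfectRing.ofSurjective K p fun x => IsAlgClosed.exists_pow_nat_eq x hp.out.pos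
  haveI : IsOpenImmersion φⱼ := inferInstanceAs (IsOpenImmersion
    (Spec.map (CommRingCat.ofHom (Θⱼ : A 4 K →+* A 4 K)) ≫ AffineCoordBlowup.chartImm hπ (succ_mem_centreVars hj)))
  haveI : IsProper π := hπ.isProper
  haveI : IsLocallyNoetherian W := LocallyOfFiniteType.isLocallyNoetherian π
  haveI : IsLocallyNoetherian W'' := hτ.isLocallyNoetherian
  -- the repair centre package and the model blowing up over the chart
  obtain ⟨hcomap, -, -, -, -, -⟩ := farRepairCentre_package_pairs hj hjS' hbj h0j hsj hπ hperm hread hperm' L hs hne hnd h0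
  have hτV := isBlowup_morphismRestrict_comp_isoOpensRange_inv φⱼ hτ
  rw [hcomap] at hτV
  obtain ⟨φV, hφV, g1, g2, g3, g4, g5, g6, g7, g8⟩ := farRepair_chart_reading_heights hjS' hs hne hnd F₁ hperm' hτV
  have hZc : Zc.comap φⱼ = AffineCoordBlowup.𝓘Λ 4 K (insert 0 (Fin.succ '' (S' : Set (Fin 4)))) := comap_globalCentre _ _
  have hideal : M'.ideal.comap φⱼ = hypSheaf p F₁ := comap_chart_transform_ideal_of_reading hj hbj h0j hsj hπ hperm hread _ rfl rfl
  -- every reading along `φV ≫ ι` is a reading of the model along `φV`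
  have hSt : ∀ D : Scheme.IdealSheafData W, (strictTransformIdeal τ CW D).comap (φV ≫ (τ ⁻¹ᵁ φⱼ.opensRange).ι) =
      (strictTransformIdeal ((τ ∣_ φⱼ.opensRange) ≫ φⱼ.isoOpensRange.inv) Cmod (D.comap φⱼ)).comap φV := by
    intro D
    rw [Scheme.IdealSheafData.comap_comp, ← strictTransformIdeal_model φⱼ, hcomap]
  refine ⟨φV ≫ (τ ⁻¹ᵁ φⱼ.opensRange).ι, inferInstance, ?_, ?_, ?_, ?_, g4, ?_, fun D a hD => ?_, fun D t ht hD => ?_, fun D i hiT hij a hD => ?_⟩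
  · -- over the `x_j`-chart
    rintro _ ⟨y, rfl⟩
    have h1 : (τ ⁻¹ᵁ φⱼ.opensRange).ι (φV y) ∈ ((τ ⁻¹ᵁ φⱼ.opensRange : W''.Opens) : Set W'') := by
      rw [← Scheme.Opens.range_ι]
      exact ⟨_, rfl⟩
    have h2 : τ ((τ ⁻¹ᵁ φⱼ.opensRange).ι (φV y)) ∈ (φⱼ.opensRange : Set W) := h1
    rw [Scheme.Hom.coe_opensRange] at h2
    rw [Scheme.Hom.comp_apply, Scheme.Hom.comp_apply]
    exact h2
  · -- (1)
    rw [hSt, hZc]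
    exact g1
  · -- (2)
    intro x hx hxj
    have hxU : x ∈ Set.range (τ ⁻¹ᵁ φⱼ.opensRange).ι := by
      rw [Scheme.Opens.range_ι]
      show τ x ∈ (φⱼ.opensRange : Set W)
      rw [Scheme.Hom.coe_opensRange]
      exact hxj
    obtain ⟨x', rfl⟩ := hxU
    have hx' := (mem_support_comap_iff _ _ x').mpr hx
    rw [← strictTransformIdeal_model φⱼ, hcomap, hZc] at hx'
    obtain ⟨y, rfl⟩ := g2 hx'
    exact ⟨y, rfl⟩
  · -- (3)
    rw [MarkedIdeal.transform_ideal, Scheme.IdealSheafData.comap_comp, ← controlledTransform_model φⱼ, hcomap, hideal]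
    exact g3
  · -- (5)
    rw [Scheme.IdealSheafData.comap_comp, ← comap_centre_model φⱼ, hcomap]
    exact g5
  · -- (6)
    rw [hSt, hD]
    exact g6 a
  · -- (7)
    rw [hSt, hD]
    exact g7 t ht
  · -- (8)
    rw [hSt, hD]
    exact g8 i hiT hij a

end Stage

end ChartDictionary

end Summit.ResolutionOfSingularities.ResolutionOfSingularities.Theorems.PIDim4

end
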